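import Mathlib
import HarnessLib

/-!
# AUT-EXT: every `ℚ`-automorphism of a subfield `L ⊆ ℂ` extends to a `ℚ`-algebra automorphism of `ℂ`
(route `ManinLocalTwoThree`, crux C2 `ManinOddAtFour` stmt-BirchSwinnertonDyer-22967; cell bsd-f2-manin, C2/C3 LEAD p1 gen 19;
`--supports stmt-BirchSwinnertonDyer-22967`; LEAD planning flag «AUT-EXT» 2026-08-30T04:20Z)

WHY.  Every modular-side Galois fact of the Kummer–diamond line — T-es-75 `optimalGamma1Parametrization_cuspInv_galoisAction`
(Stevens 1982 Thm. 1.3.1(b)), p2's `theoremK_core`, es's `indexFour_kummerDiamondReciprocity` — is quantified over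
`σ : ℂ ≃ₐ[ℚ] ℂ` with `σ(e^{2πi/N}) = e^{2πi d/N}` as a HYPOTHESIS.  To read square classes out of them (E-es-185 STEP 2 needs a `σ` for
EVERY `d ∈ (ℤ/N)ˣ`; Kummer injectivity needs a `σ` moving `√m`) one must be able to EXTEND automorphisms of number fields inside `ℂ`
to `ℂ`.  This file proves the supply lemma (transcendence basis of `ℂ/L`, `τ` on the coefficients of `L[B]`, uniqueness of algebraic
closures up to isomorphism over an isomorphism of the base):

* `exists_complex_algEquiv_extends` — for every intermediate field `L` of `ℂ/ℚ` and every `τ : L ≃ₐ[ℚ] L` there is `σ : ℂ ≃ₐ[ℚ] ℂ`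
  with `σ x = τ x` on `L`.

Pure field theory (Steinitz); nothing about C2, Manin's conjecture or BSD is proved here.  [folklore]
-/

set_option autoImplicit false
-- lint-debt: the directory name repeats the summit name (sibling precedent `ManinLocalTwoThreeKummerDiamondDescentStepTwo.lean`)
set_option linter.dupNamespace false

noncomputable section

open scoped Classical

namespace Summit.BirchSwinnertonDyer.BirchSwinnertonDyer.Theorems.ManinLocalTwoThree.ComplexAut

/-- **AUT-EXT (Steinitz).**  Every `ℚ`-algebra automorphism `τ` of an intermediate field `L` of `ℂ/ℚ` is the restriction of a
`ℚ`-algebra automorphism `σ` of `ℂ`: choose a transcendence basis `B` of `ℂ` over `L`, let `τ` act on the coefficients of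
`L[B] ≅ MvPolynomial B L`, and extend to the algebraic closure `ℂ` of `L[B]` (`IsAlgClosure.equivOfEquiv`). [folklore] -/
theorem exists_complex_algEquiv_extends (L : IntermediateField ℚ ℂ) (τ : L ≃ₐ[ℚ] L) :
    ∃ σ : ℂ ≃ₐ[ℚ] ℂ, ∀ x : L, σ (x : ℂ) = ((τ x : L) : ℂ) := by
  -- a transcendence basis of `ℂ` over `L`
  obtain ⟨s, hs⟩ := exists_isTranscendenceBasis L ℂ
  set A : Subalgebra L ℂ := Algebra.adjoin L (Set.range ((↑) : s → ℂ)) with hA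
  haveI hAC : IsAlgClosure A ℂ := IsAlgClosed.isAlgClosure_of_transcendence_basis _ hs
  -- `τ` acting on coefficients: a ring automorphism of `A = L[B]` over `τ`
  let e : A ≃+* A :=
    (hs.1.aevalEquiv.symm.toRingEquiv.trans (MvPolynomial.mapEquiv s τ.toRingEquiv)).trans hs.1.aevalEquiv.toRingEquiv
  have he : ∀ x : L, e (algebraMap L A x) = algebraMap L A (τ x) := by
    intro x
    simp only [e, RingEquiv.trans_apply, AlgEquiv.coe_ringEquiv]
    have h1 : hs.1.aevalEquiv.symm (algebraMap L A x) = MvPolynomial.C x := by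
      rw [AlgEquiv.symm_apply_eq, ← MvPolynomial.algebraMap_eq, AlgEquiv.commutes]
    rw [h1, MvPolynomial.mapEquiv_apply, AlgEquiv.toRingEquiv_toRingHom]
    change hs.1.aevalEquiv (MvPolynomial.map (τ : L →+* L) (MvPolynomial.C x)) = _
    rw [MvPolynomial.map_C, ← MvPolynomial.algebraMap_eq, AlgEquiv.commutes]
    rfl
  -- extend to the algebraic closure `ℂ` of `A`
  let σ₀ : ℂ ≃+* ℂ := IsAlgClosure.equivOfEquiv (S := A) (R := A) ℂ ℂ e
  have hσ₀ : ∀ a : A, σ₀ (algebraMap A ℂ a) = algebraMap A ℂ (e a) := fun a =>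
    IsAlgClosure.equivOfEquiv_algebraMap (S := A) (R := A) ℂ ℂ e a
  -- `ℚ`-linearity is automatic
  refine ⟨AlgEquiv.ofRingEquiv (f := σ₀) (fun q => ?_), fun x => ?_⟩
  · rw [Algebra.algebraMap_eq_smul_one, map_rat_smul, map_one]
  · show σ₀ (x : ℂ) = ((τ x : L) : ℂ)
    have hx : (x : ℂ) = algebraMap A ℂ (algebraMap L A x) := rfl
    rw [hx, hσ₀, he]
    rfl

end Summit.BirchSwinnertonDyer.BirchSwinnertonDyer.Theorems.ManinLocalTwoThree.ComplexAut

end
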